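import Literature.Probability.RandomPlanarGeometry.USTPeanoTreeLaw
import Literature.Probability.RandomPlanarGeometry.USTPeanoPeelAlong
import HarnessLib

/-!
# The Markov property of the UST Peano path law ([LSW04] Lemma 4.1), measure form

G. F. Lawler, O. Schramm, W. Werner, Ann. Probab. **32** (2004), Lemma 4.1 (Markovian property,
p. 972): "Let `1 ≤ n ≤ ℓ`. Conditioned on `γ[0, n]`, the distribution of the remaining path is
the same as that of the UST Peano path from `γ(n)` to `b` in `D_n = D(α_n, β_n, γ(n), b)`."

For a domain `D ∈ 𝔇*` the UST Peano path law `ustLaw D` is uniform on the Peano paths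
(`USTPeanoPath.lean`), the Peano paths of `D` are the combinatorial Peano paths of its peeling
data (`Domain.peanoPathEquiv`, `USTPeanoTreeLaw.lean`), and those with a given prefix are in
bijection with the Peano paths of the data peeled along the prefix (`PeelData.Good.prefixEquiv`,
`USTPeanoPeelAlong.lean`).  Hence (`Domain.ustLaw_prefix_and_eq`): for every prefix
`w = (γ(1), …, γ(n))` that occurs and every property `P` of the remainder,
`P[γ[0,n] = (a, w) ∧ P(γ[n, ℓ+1])] = P[γ[0,n] = (a, w)] · #{P-paths of D_n} / #{paths of D_n}`,
the uniform (UST Peano) law of the peeled data `D_n = D.peelData.peelAlong w` as the conditional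
law.  (`D_n` is kept combinatorial: its wired wall `α_n` is a tree, outside the simple-path
domains of `USTPeanoDomain.lean`.)
-/

noncomputable section

open scoped ENNReal
open MeasureTheory

namespace Literature.Probability.RandomPlanarGeometry

namespace USTPeano

namespace Domain

variable (D : Domain)

/-- The UST Peano path law of a set of paths, as a ratio of cardinalities. [folklore] -/
theorem ustLaw_setOf_eq (Q : PeanoPath D → Prop) :
    ustLaw D {γ | Q γ} = (Nat.card {γ // Q γ} : ℝ≥0∞) / (Nat.card (PeanoPath D) : ℝ≥0∞) := by
  rw [ustLaw_apply, Measure.count_apply MeasurableSpace.measurableSet_top,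
    ← (Set.toFinite _).cast_ncard_eq, ← Nat.card_coe_set_eq, ENat.toENNReal_coe,
    Nat.card_eq_fintype_card (α := PeanoPath D)]
  rfl

/-- The Peano paths of `D` with a given prefix are the combinatorial Peano paths of its peeling
data with that prefix. [folklore] -/
def prefixPathsEquiv (w : List (ℤ × ℤ)) :
    {γ : PeanoPath D // w <+: γ.verts.tail} ≃ {l // D.peelData.IsPath l ∧ w <+: l.tail} where
  toFun γ := ⟨γ.1.verts, γ.1.isPath_verts, γ.2⟩
  invFun l := ⟨D.peanoPath l.2.1, l.2.2⟩
  left_inv _ := Subtype.ext (PeanoPath.verts_injective rfl)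
  right_inv _ := rfl

/-- The same, together with a property of the remainder. [folklore] -/
def prefixPathsAndEquiv (w : List (ℤ × ℤ)) (P : List (ℤ × ℤ) → Prop) :
    {γ : PeanoPath D // w <+: γ.verts.tail ∧ P (γ.verts.drop w.length)} ≃
      {γ : {l // D.peelData.IsPath l ∧ w <+: l.tail} // P (γ.1.drop w.length)} where
  toFun γ := ⟨⟨γ.1.verts, γ.1.isPath_verts, γ.2.1⟩, γ.2.2⟩
  invFun l := ⟨D.peanoPath l.1.2.1, l.1.2.2, l.2⟩
  left_inv _ := Subtype.ext (PeanoPath.verts_injective rfl)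
  right_inv _ := rfl

/-- **The number of Peano paths of `D` with an occurring prefix `a, q₁, …, q_n` is the number of
Peano paths of the data peeled along it.** [cite: LawlerSchrammWerner2004, Lemma 4.1] -/
theorem card_prefix_eq {w : List (ℤ × ℤ)} (hne : ∃ γ : PeanoPath D, w <+: γ.verts.tail)
    (hb : D.b ∉ w) :
    Nat.card {γ : PeanoPath D // w <+: γ.verts.tail} =
      Nat.card {l // (D.peelData.peelAlong w).IsPath l} := by
  obtain ⟨γ₀, h₀⟩ := hne
  rw [Nat.card_congr (D.prefixPathsEquiv w)]
  exact D.good_peelData.card_prefix_eq ⟨γ₀.verts, γ₀.isPath_verts, h₀⟩ hb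

/-- The same with a property of the remainder. [cite: LawlerSchrammWerner2004, Lemma 4.1] -/
theorem card_prefix_and_eq {w : List (ℤ × ℤ)} (hne : ∃ γ : PeanoPath D, w <+: γ.verts.tail)
    (hb : D.b ∉ w) (P : List (ℤ × ℤ) → Prop) :
    Nat.card {γ : PeanoPath D // w <+: γ.verts.tail ∧ P (γ.verts.drop w.length)} =
      Nat.card {l : {l // (D.peelData.peelAlong w).IsPath l} // P l.1} := by
  obtain ⟨γ₀, h₀⟩ := hne
  rw [Nat.card_congr (D.prefixPathsAndEquiv w P)]
  exact D.good_peelData.card_prefix_and_eq ⟨γ₀.verts, γ₀.isPath_verts, h₀⟩ hb P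

/-- The UST Peano path law of a prefix: `#{Peano paths of D_n} / #{Peano paths of D}`.
[cite: LawlerSchrammWerner2004, Lemma 4.1] -/
theorem ustLaw_prefix_eq {w : List (ℤ × ℤ)} (hne : ∃ γ : PeanoPath D, w <+: γ.verts.tail)
    (hb : D.b ∉ w) :
    ustLaw D {γ | w <+: γ.verts.tail} =
      (Nat.card {l // (D.peelData.peelAlong w).IsPath l} : ℝ≥0∞) / Nat.card (PeanoPath D) := by
  rw [D.ustLaw_setOf_eq, D.card_prefix_eq hne hb]

/-- **The Markov property of the UST Peano path ([LSW04] Lemma 4.1), measure form**: for every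
prefix `a, q₁, …, q_n` that occurs (not reaching `b`) and every property `P` of the remainder
`γ[n, ℓ+1]`,
`ustLaw D {prefix ∧ P(remainder)} = ustLaw D {prefix} · (#{P-Peano paths of D_n} / #{Peano paths of D_n})`
with `D_n = D.peelData.peelAlong [q₁, …, q_n]`: conditioned on `γ[0, n]`, the remainder is the
(uniform) UST Peano path of the peeled data. [cite: LawlerSchrammWerner2004, Lemma 4.1] -/
theorem ustLaw_prefix_and_eq {w : List (ℤ × ℤ)} (hne : ∃ γ : PeanoPath D, w <+: γ.verts.tail)
    (hb : D.b ∉ w) (P : List (ℤ × ℤ) → Prop) :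
    ustLaw D {γ | w <+: γ.verts.tail ∧ P (γ.verts.drop w.length)} =
      ustLaw D {γ | w <+: γ.verts.tail} *
        ((Nat.card {l : {l // (D.peelData.peelAlong w).IsPath l} // P l.1} : ℝ≥0∞) /
          Nat.card {l // (D.peelData.peelAlong w).IsPath l}) := by
  rw [D.ustLaw_setOf_eq, D.ustLaw_setOf_eq, D.card_prefix_and_eq hne hb P, D.card_prefix_eq hne hb]
  set A := (Nat.card {l : {l // (D.peelData.peelAlong w).IsPath l} // P l.1} : ℝ≥0∞)
  set M := (Nat.card {l // (D.peelData.peelAlong w).IsPath l} : ℝ≥0∞) with hM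
  set N := (Nat.card (PeanoPath D) : ℝ≥0∞)
  have hM0 : M ≠ 0 := by
    rw [hM, ← D.card_prefix_eq hne hb, Nat.cast_ne_zero]
    obtain ⟨γ₀, h₀⟩ := hne
    haveI : Nonempty {γ : PeanoPath D // w <+: γ.verts.tail} := ⟨⟨γ₀, h₀⟩⟩
    exact Nat.card_pos.ne'
  have hMt : M ≠ ⊤ := ENNReal.natCast_ne_top _
  calc A / N = M * M⁻¹ * (A / N) := by rw [ENNReal.mul_inv_cancel hM0 hMt, one_mul]
    _ = M / N * (A / M) := by simp only [div_eq_mul_inv]; ring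

end Domain

end USTPeano

end Literature.Probability.RandomPlanarGeometry
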